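import Literature.NumberTheory.Automorphic.LevelControlDegreeZero
import HarnessLib

/-!
# Nilpotency of the `U_p`-type operator on `H⁰`: sections shifted by coefficient endomorphisms

Topic `NumberTheory/Automorphic`; namespace `Literature.NumberTheory.Automorphic.LevelAction`;
theorems only (no new definitions, no named fact, no `sorry`).  Universe `0`.

The variant of `LevelControlDegreeZero` needed for NON-trivial coefficients `V` (e.g.
`V = Sym^{k-2}`): there a `Γ`-invariant section `F` of `𝓕(N) = M(U', N ⊗ V)` does not take equal
values at the representatives `g α_j = g N(x_j) t`, but (strong approximation + the section property,
the unipotents `N(x_j)` acting invertibly on `V`) `F(g α_j) = (1 ⊗ e_j) F(g b)` for a fixed `b`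
(`= t`) and fixed `e_j ∈ End V` (`= τ(N(-x_j))`).  Under this hypothesis (`hshift`):

* `coe_pow_inducedHecke_apply_of_shift` — `(U^m F)(g) = (1 ⊗ B'^m) F(g b^m)` with
  `B' = ∑_j τ(α_j) e_j`;
* **`inducedHeckeCohomology_zero_pow_eq_zero_of_shift`** — `B'^n = 0` on `V` implies `U^n = 0`
  on `H⁰(Γ, 𝓕(N))` for every `Q`-module `N`. [cite: Hida1994AIF, §3, proof of Thm 3.2]
  [cite: KhareThorne2017, §6.3]

## References

* H. Hida, Ann. Inst. Fourier 44 (1994), §3. [Hida1994AIF]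
* C. Khare, J. A. Thorne, Amer. J. Math. 139 (2017), §6.3. [KhareThorne2017]
-/

noncomputable section

open CategoryTheory groupCohomology
open scoped TensorProduct

namespace Literature.NumberTheory.Automorphic

namespace LevelAction

variable {R : Type} [CommRing R] {Γ 𝒢 : Type} [Group Γ] [Group 𝒢] (ι : Γ →* 𝒢)
  {Δ : Submonoid 𝒢} {V : Type} [AddCommGroup V] [Module R V] (τ : Δ →* Module.End R V)
  {U' : Subgroup 𝒢} (hU' : U'.toSubmonoid ≤ Δ) {Q : Type} [Group Q] (π : U' →* Q)
  {N : Type} [AddCommGroup N] [Module R N] (ρ : Representation R Q N)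
  {J : Type} [Fintype J] {a : J → 𝒢}

/-- **The `U_p`-type operator on a section shifted by coefficient endomorphisms**:
if `F(g α_j) = (1 ⊗ e_j) F(g b)` for all `j`, then `(U F)(g) = (1 ⊗ B') F(g b)`,
`B' = ∑_j τ(α_j) e_j`. [cite: Hida1994AIF, §3] -/
theorem inducedHeckeFun_apply_of_forall_eq_lTensor (ha : IsAdaptedFamily Δ U' π a) (b : 𝒢)
    (e : J → Module.End R V) (F : 𝒢 → N ⊗[R] V) (g : 𝒢)
    (hF : ∀ j, F (g * a j) = (e j).lTensor N (F (g * b))) :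
    inducedHeckeFun τ π ha F g = (∑ j, τ ⟨a j, ha.mem j⟩ * e j).lTensor N (F (g * b)) := by
  rw [inducedHeckeFun_apply, lTensor_sum', LinearMap.sum_apply]
  exact Finset.sum_congr rfl fun j _ => by
    rw [hF j, LinearMap.lTensor_mul, Module.End.mul_apply]

/-- **Iterating on `Γ`-invariant sections** under the shift hypothesis `hshift`:
`(U^m F)(g) = (1 ⊗ B'^m) F(g b^m)`. [cite: Hida1994AIF, §3, proof of Thm 3.2] -/
theorem coe_pow_inducedHecke_apply_of_shift (ha : IsAdaptedFamily Δ U' π a) (b : 𝒢)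
    (e : J → Module.End R V)
    (hshift : ∀ F : 𝒢 → N ⊗[R] V, F ∈ sections U'.toSubmonoid (inducedCoeff τ hU' π ρ) U' →
      (∀ γ : Γ, leftTranslation R ι (N ⊗[R] V) γ F = F) →
        ∀ (g : 𝒢) (j : J), F (g * a j) = (e j).lTensor N (F (g * b)))
    (m : ℕ) (F : inducedRep ι τ hU' π ρ) (hF : ∀ γ : Γ, (inducedRep ι τ hU' π ρ).ρ γ F = F) (g : 𝒢) :
    ((((inducedHecke ι τ hU' π ρ ha).hom.toLinearMap ^ m) F :
        sections U'.toSubmonoid (inducedCoeff τ hU' π ρ) U') : 𝒢 → N ⊗[R] V) g =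
      ((∑ j, τ ⟨a j, ha.mem j⟩ * e j) ^ m).lTensor N ((F : 𝒢 → N ⊗[R] V) (g * b ^ m)) := by
  induction m generalizing F g with
  | zero =>
    rw [pow_zero, pow_zero, pow_zero, mul_one, Module.End.one_apply, Module.End.one_eq_id,
      LinearMap.lTensor_id, LinearMap.id_apply]
  | succ m ih =>
    have hF' : ∀ γ : Γ, (inducedRep ι τ hU' π ρ).ρ γ ((inducedHecke ι τ hU' π ρ ha).hom.toLinearMap F) =
        (inducedHecke ι τ hU' π ρ ha).hom.toLinearMap F := fun γ => by
      have h := Rep.hom_comm_apply (inducedHecke ι τ hU' π ρ ha) γ F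
      rw [hF γ] at h
      exact h.symm
    have hinv : ∀ γ : Γ, leftTranslation R ι (N ⊗[R] V) γ (F : 𝒢 → N ⊗[R] V) = (F : 𝒢 → N ⊗[R] V) :=
      fun γ => congrArg Subtype.val (hF γ)
    rw [pow_succ, Module.End.mul_apply, ih _ hF' g]
    change ((∑ j, τ ⟨a j, ha.mem j⟩ * e j) ^ m).lTensor N
        (inducedHeckeFun τ π ha (F : 𝒢 → N ⊗[R] V) (g * b ^ m)) = _
    rw [inducedHeckeFun_apply_of_forall_eq_lTensor τ π ha b e _ _ (hshift _ F.2 hinv (g * b ^ m)),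
      ← LinearMap.comp_apply, ← LinearMap.lTensor_comp, ← Module.End.mul_eq_comp, ← pow_succ,
      mul_assoc, ← pow_succ]

/-- **`B'^n = 0` on `V` (and `hshift`) imply `U^n = 0` on `H⁰(Γ, 𝓕 N)`**, for every `Q`-module `N`.
[cite: Hida1994AIF, §3, proof of Thm 3.2] [cite: KhareThorne2017, §6.3] -/
theorem inducedHeckeCohomology_zero_pow_eq_zero_of_shift (ha : IsAdaptedFamily Δ U' π a) (b : 𝒢)
    (e : J → Module.End R V)
    (hshift : ∀ F : 𝒢 → N ⊗[R] V, F ∈ sections U'.toSubmonoid (inducedCoeff τ hU' π ρ) U' →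
      (∀ γ : Γ, leftTranslation R ι (N ⊗[R] V) γ F = F) →
        ∀ (g : 𝒢) (j : J), F (g * a j) = (e j).lTensor N (F (g * b)))
    {n : ℕ} (hB : (∑ j, τ ⟨a j, ha.mem j⟩ * e j) ^ n = 0) :
    inducedHeckeCohomology ι τ hU' π ha (ρ := ρ) 0 ^ n = 0 := by
  refine LinearMap.ext fun c => ?_
  have hinj : Function.Injective ((H0Iso (inducedRep ι τ hU' π ρ)).hom :
      inducedCohomology ι τ hU' π ρ 0 → _) := (H0Iso (inducedRep ι τ hU' π ρ)).toLinearEquiv.injective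
  apply hinj
  rw [LinearMap.zero_apply, map_zero]
  apply Subtype.ext
  rw [coe_H0Iso_hom_inducedHeckeCohomology_pow, ZeroMemClass.coe_zero]
  set w := (H0Iso (inducedRep ι τ hU' π ρ)).hom c
  have hw : ∀ γ : Γ, (inducedRep ι τ hU' π ρ).ρ γ (w : inducedRep ι τ hU' π ρ) = w := fun γ => w.2 γ
  refine Subtype.ext (funext fun g => ?_)
  rw [coe_pow_inducedHecke_apply_of_shift ι τ hU' π ρ ha b e hshift n _ hw g, hB,
    LinearMap.lTensor_zero, LinearMap.zero_apply]
  rfl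

/-- Pointwise form. [folklore] -/
theorem inducedHeckeCohomology_zero_pow_apply_eq_zero_of_shift (ha : IsAdaptedFamily Δ U' π a)
    (b : 𝒢) (e : J → Module.End R V)
    (hshift : ∀ F : 𝒢 → N ⊗[R] V, F ∈ sections U'.toSubmonoid (inducedCoeff τ hU' π ρ) U' →
      (∀ γ : Γ, leftTranslation R ι (N ⊗[R] V) γ F = F) →
        ∀ (g : 𝒢) (j : J), F (g * a j) = (e j).lTensor N (F (g * b)))
    {n : ℕ} (hB : (∑ j, τ ⟨a j, ha.mem j⟩ * e j) ^ n = 0) (c : inducedCohomology ι τ hU' π ρ 0) :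
    (inducedHeckeCohomology ι τ hU' π ha 0 ^ n) c = 0 := by
  rw [inducedHeckeCohomology_zero_pow_eq_zero_of_shift ι τ hU' π ρ ha b e hshift hB,
    LinearMap.zero_apply]

end LevelAction

end Literature.NumberTheory.Automorphic
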